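import Mathlib.FieldTheory.IntermediateField.Adjoin.Defs
import Literature.Combinatorics.Additive.LinearKneser
import Literature.Combinatorics.Additive.LinearKneserKernels
import HarnessLib

/-!
# Kneser's theorem for field extensions — proof of `LinearKneser` (Bachoc–Serra–Zémor §4)

Topic `Literature/Combinatorics/Additive`; last proof file behind the named fact
`Literature.Combinatorics.Additive.LinearKneser` (`LinearKneser.lean`): the theorem of
Hou–Leung–Xiang (J. Number Theory 97 (2002), main theorem) WITHOUT its separability assumption,
following C. Bachoc, O. Serra, G. Zémor, *Revisiting Kneser's theorem for field extensions*,
Combinatorica 38 (2018) = arXiv:1510.01354 (BSZ), §4, on top of the structure theory of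
`LinearKneserKernels.lean` (BSZ Theorem 15 / Theorem 3 for `L = F(S)`).

* `exists_smul_le_of_gen` — BSZ Theorem 3 inside a field `L₀ = F(S)`: one element `k ∉ F`
  with `k·TS ⊆ TS` for every `T` of small product (the three cases `H(S) ≠ F`, BSZ §3, and
  "every small `T` has `TS = L₀`").
* `exists_mem_mulStabilizer` — BSZ Theorem 3 ⇒ Theorem 2 for an arbitrary extension `L ⊇ F(S)`
  (BSZ §4, last paragraph: `T = Σ_t T ∩ tF(S)` and each `T ∩ tF(S)` again has small product;
  we count with the modular law instead of choosing complements), transported to the subfield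
  `F(S)` = `IntermediateField.adjoin F S` and back.
* `LinearKneser_holds` — the stabiliser form `dim ST ≥ dim S + dim T - dim H(ST)`, from the
  dichotomy by induction on `dim_F ST` with a change of base field to `K = H(ST)` (the standard
  equivalence quoted from Hou–Leung–Xiang in BSZ §1): over `K`, `(KS)(KT) = ST` has trivial
  stabiliser, and the tower law converts `K`-dimensions back to `F`-dimensions.

## References
* [BachocSerraZemor2018Kneser] C. Bachoc, O. Serra, G. Zémor, Combinatorica 38 (2018) 759–777,
  Theorems 2, 3 and §4.
* [HouLeungXiang2002] X.-D. Hou, K. H. Leung, Q. Xiang, J. Number Theory 97 (2002) 1–9, main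
  theorem (the statement discharged here; equivalence of the two forms as quoted in BSZ §1).
-/

noncomputable section

open Module Submodule
open scoped Pointwise

namespace Literature.Combinatorics.Additive.LinKneser

variable {F L : Type*} [Field F] [Field L] [Algebra F L]

attribute [local instance] finiteDimensional_mul finiteDimensional_smul

/-! ### The stabiliser `H(X)` of a finite-dimensional subspace is a finite extension field -/

/-- `H(X)` is closed under inverses when `X` is finite-dimensional (multiplication by `k ≠ 0`
is an injective endomorphism of `X`, hence onto).
[cite: BachocSerraZemor2018Kneser, Section 2.3 (remark before Corollary 14)] -/
theorem inv_mem_mulStabilizer {X : Submodule F L} [FiniteDimensional F X] {k : L}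
    (hk : k ∈ mulStabilizer X) : k⁻¹ ∈ mulStabilizer X := by
  by_cases hk0 : k = 0
  · rw [hk0, inv_zero]
    exact (mulStabilizer X).zero_mem
  intro x hx
  let f : X →ₗ[F] X :=
    { toFun := fun y => ⟨k * y, hk y y.2⟩
      map_add' := fun y z => by ext; simp [mul_add]
      map_smul' := fun c y => by ext; simp }
  have hinj : Function.Injective f := by
    intro y z hyz
    have : k * y = k * z := congrArg Subtype.val hyz
    exact Subtype.ext (mul_left_cancel₀ hk0 this)
  obtain ⟨y, hy⟩ := (LinearMap.injective_iff_surjective.mp hinj) ⟨x, hx⟩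
  have hxy : k * y = x := congrArg Subtype.val hy
  rw [← hxy, ← mul_assoc, inv_mul_cancel₀ hk0, one_mul]
  exact y.2

/-- The stabiliser `H(X)` of a finite-dimensional subspace as an intermediate field.
[cite: BachocSerraZemor2018Kneser, Corollary 14] -/
def stabField (X : Submodule F L) [FiniteDimensional F X] : IntermediateField F L :=
  (mulStabilizer X).toIntermediateField fun _ hk => inv_mem_mulStabilizer hk

/-- Membership in `stabField`. [cite: BachocSerraZemor2018Kneser, Corollary 14] -/
theorem mem_stabField {X : Submodule F L} [FiniteDimensional F X] {k : L} :
    k ∈ stabField X ↔ ∀ x ∈ X, k * x ∈ X :=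
  Iff.rfl

/-- `H(X)` is finite-dimensional for `X ≠ 0` finite-dimensional (it embeds in `X` by
`k ↦ k x₀`). [cite: BachocSerraZemor2018Kneser, Section 2.3] -/
theorem finiteDimensional_mulStabilizer {X : Submodule F L} [FiniteDimensional F X] (hX : X ≠ ⊥) :
    FiniteDimensional F (mulStabilizer X) := by
  obtain ⟨z, hz, hz0⟩ := (Submodule.ne_bot_iff X).mp hX
  let f : mulStabilizer X →ₗ[F] X :=
    { toFun := fun k => ⟨k.1 * z, k.2 z hz⟩
      map_add' := fun a b => by ext; simp [add_mul]
      map_smul' := fun c a => by ext; simp }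
  have hinj : Function.Injective f := by
    intro a b hab
    have : (a : L) * z = b * z := congrArg Subtype.val hab
    exact Subtype.ext (mul_right_cancel₀ hz0 this)
  exact Module.Finite.of_injective f hinj

/-- `stabField X` and `H(X)` are the same `F`-space. [cite: BachocSerraZemor2018Kneser, Corollary 14] -/
def stabFieldEquiv (X : Submodule F L) [FiniteDimensional F X] :
    ↥(stabField X) ≃ₗ[F] ↥(mulStabilizer X) :=
  { toFun := fun x => ⟨x.1, x.2⟩
    invFun := fun x => ⟨x.1, x.2⟩
    map_add' := fun _ _ => rfl
    map_smul' := fun _ _ => rfl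
    left_inv := fun _ => rfl
    right_inv := fun _ => rfl }

/-- `stabField X` has the `F`-dimension of `H(X)`. [cite: BachocSerraZemor2018Kneser, Corollary 14] -/
theorem finrank_stabField (X : Submodule F L) [FiniteDimensional F X] :
    finrank F (stabField X) = finrank F (mulStabilizer X) :=
  (stabFieldEquiv X).finrank_eq

/-- The stabiliser is invariant under translation: `H(a • X) = H(X)` (`a ≠ 0`).
[cite: BachocSerraZemor2018Kneser, Section 4 (first sentence)] -/
theorem mem_mulStabilizer_smul_iff {a : L} (ha : a ≠ 0) {X : Submodule F L} {k : L} :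
    k ∈ mulStabilizer (a • X) ↔ k ∈ mulStabilizer X := by
  simp only [mem_mulStabilizer]
  constructor
  · intro h x hx
    have := h (a * x) (mul_mem_smul hx)
    rw [mul_left_comm, mul_mem_smul_iff ha] at this
    exact this
  · intro h y hy
    obtain ⟨x, hx, rfl⟩ := mem_smul_iff.mp hy
    rw [mul_left_comm]
    exact mul_mem_smul (h x hx)

/-! ### BSZ Theorem 3 inside `L₀ = F(S)` -/

/-- **BSZ Theorem 3, case `L = F(S)`**: if `1 ∈ S`, every finite-dimensional `X` with `XS ⊆ X`
is `0` or `L`, and some `T ≠ 0` has `dim TS ≤ dim T + dim S - 2`, then there is `k ∉ F` with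
`k · TS ⊆ TS` for every such `T` (one `k` for all `T`).
[cite: BachocSerraZemor2018Kneser, Theorem 3 and Section 4] -/
theorem exists_smul_le_of_gen (S : Submodule F L) [FiniteDimensional F S] (h1 : (1 : L) ∈ S)
    (hgen : ∀ X : Submodule F L, FiniteDimensional F X → X * S ≤ X → X = ⊥ ∨ X = ⊤)
    (hsmall : ∃ T : Submodule F L, FiniteDimensional F T ∧ T ≠ ⊥ ∧
      finrank F ↥(T * S) + 2 ≤ finrank F T + finrank F S) :
    ∃ k : L, k ∉ Submodule.span F {(1 : L)} ∧ ∀ T : Submodule F L, FiniteDimensional F T → T ≠ ⊥ →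
      finrank F ↥(T * S) + 2 ≤ finrank F T + finrank F S → k • (T * S) ≤ T * S := by
  have h2 : 2 ≤ finrank F S := by
    obtain ⟨T, hT, -, hsm⟩ := hsmall
    haveI := hT
    have := finrank_le_finrank_mul h1 T
    omega
  by_cases hsat : satur S (Submodule.span F {(1 : L)}) = Submodule.span F {(1 : L)}
  · by_cases hex : ∃ T : Submodule F L, FiniteDimensional F T ∧ T ≠ ⊥ ∧ T * S ≠ ⊤ ∧
        finrank F ↥(T * S) + 2 ≤ finrank F T + finrank F S
    · have H : Hyp S := ⟨h1, hgen, hsat, hex⟩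
      obtain ⟨K, h1K, hK1, -, -, hK⟩ := H.exists_stabilizer
      obtain ⟨k, hkK, hk1⟩ : ∃ k ∈ K, k ∉ Submodule.span F {(1 : L)} := by
        by_contra h
        push Not at h
        exact hK1 (le_antisymm h ((Submodule.span_singleton_le_iff_mem 1 K).mpr h1K))
      refine ⟨k, hk1, fun T hT hTb hsm => ?_⟩
      rw [← span_singleton_mul]
      exact (mul_le_mul_left ((Submodule.span_singleton_le_iff_mem k K).mpr hkK) _).trans
        (hK T hT hTb hsm)
    · push Not at hex
      obtain ⟨k, hkS, hk1⟩ : ∃ k ∈ S, k ∉ Submodule.span F {(1 : L)} := by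
        by_contra h
        push Not at h
        have := Submodule.finrank_mono (show S ≤ Submodule.span F {(1 : L)} from h)
        rw [finrank_span_singleton one_ne_zero] at this
        omega
      refine ⟨k, hk1, fun T hT hTb hsm => ?_⟩
      have : T * S = ⊤ := by
        by_contra hne
        exact absurd hsm (not_le.mpr (hex T hT hTb hne))
      rw [this]
      exact le_top
  · obtain ⟨k, hk, hk1⟩ := SetLike.exists_of_lt (lt_of_le_of_ne (le_satur S _) (Ne.symm hsat))
    refine ⟨k, hk1, fun T hT hTb hsm => ?_⟩
    have hkS : k • S ≤ S := by
      have := mem_satur_iff_smul_le.mp hk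
      rwa [← Submodule.one_eq_span, one_mul] at this
    calc k • (T * S) = (k • S) * T := by rw [mul_comm, smul_mul, mul_comm]
      _ ≤ S * T := mul_le_mul_left hkS T
      _ = T * S := mul_comm S T

/-! ### Transport along the inclusion of an intermediate field -/

section Transport

variable (L₀ : IntermediateField F L)

/-- The inclusion `L₀ → L` as an `F`-linear map. [folklore] -/
abbrev incl : ↥L₀ →ₗ[F] L := (L₀.val : ↥L₀ →ₐ[F] L).toLinearMap

/-- The inclusion is injective. [folklore] -/
theorem incl_injective : Function.Injective (incl L₀) := fun _ _ h => Subtype.ext h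

/-- Its range is `L₀`. [folklore] -/
theorem mem_range_incl {x : L} : x ∈ LinearMap.range (incl L₀) ↔ x ∈ L₀ :=
  ⟨fun ⟨y, hy⟩ => hy ▸ y.2, fun hx => ⟨⟨x, hx⟩, rfl⟩⟩

/-- `map ∘ comap = id` on subspaces of `L₀`. [folklore] -/
theorem map_comap_incl {X : Submodule F L} (hX : (X : Set L) ⊆ L₀) :
    (X.comap (incl L₀)).map (incl L₀) = X := by
  rw [Submodule.map_comap_eq]
  exact inf_eq_right.mpr fun x hx => (mem_range_incl L₀).mpr (hX hx)

/-- `map` preserves dimension. [folklore] -/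
theorem finrank_map_incl (Y : Submodule F ↥L₀) :
    finrank F ↥(Y.map (incl L₀)) = finrank F Y :=
  (Submodule.equivMapOfInjective _ (incl_injective L₀) Y).finrank_eq.symm

/-- `comap` preserves dimension on subspaces of `L₀`. [folklore] -/
theorem finrank_comap_incl {X : Submodule F L} (hX : (X : Set L) ⊆ L₀) :
    finrank F ↥(X.comap (incl L₀)) = finrank F X := by
  rw [← finrank_map_incl L₀, map_comap_incl L₀ hX]

/-- `comap` of a finite-dimensional subspace of `L₀` is finite-dimensional. [folklore] -/
theorem finiteDimensional_comap_incl {X : Submodule F L} [FiniteDimensional F X]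
    (hX : (X : Set L) ⊆ L₀) : FiniteDimensional F ↥(X.comap (incl L₀)) := by
  have e := Submodule.equivMapOfInjective _ (incl_injective L₀) (X.comap (incl L₀))
  rw [map_comap_incl L₀ hX] at e
  exact Module.Finite.equiv e.symm

/-- `map` commutes with products. [folklore] -/
theorem map_incl_mul (Y₁ Y₂ : Submodule F ↥L₀) :
    (Y₁ * Y₂).map (incl L₀) = Y₁.map (incl L₀) * Y₂.map (incl L₀) :=
  Submodule.map_mul Y₁ Y₂ (L₀.val : ↥L₀ →ₐ[F] L)

/-- `comap` commutes with products on subspaces of `L₀`. [folklore] -/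
theorem comap_incl_mul {X₁ X₂ : Submodule F L} (h₁ : (X₁ : Set L) ⊆ L₀) (h₂ : (X₂ : Set L) ⊆ L₀) :
    X₁.comap (incl L₀) * X₂.comap (incl L₀) = (X₁ * X₂).comap (incl L₀) := by
  apply Submodule.map_injective_of_injective (incl_injective L₀)
  have h12 : ((X₁ * X₂ : Submodule F L) : Set L) ⊆ L₀ := by
    intro z hz
    refine Submodule.mul_induction_on hz (fun a ha b hb => L₀.mul_mem (h₁ ha) (h₂ hb))
      (fun a b ha hb => L₀.add_mem ha hb)
  rw [map_incl_mul, map_comap_incl L₀ h₁, map_comap_incl L₀ h₂, map_comap_incl L₀ h12]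

/-- `map` turns translates into translates. [folklore] -/
theorem map_incl_smul (k : ↥L₀) (Y : Submodule F ↥L₀) :
    (k • Y).map (incl L₀) = (k : L) • Y.map (incl L₀) := by
  ext x
  simp only [Submodule.mem_map, mem_smul_iff]
  constructor
  · rintro ⟨y, hy, rfl⟩
    obtain ⟨z, hz, rfl⟩ := mem_smul_iff.mp hy
    exact ⟨z, ⟨z, hz, rfl⟩, rfl⟩
  · rintro ⟨y, ⟨z, hz, rfl⟩, rfl⟩
    exact ⟨k * z, mul_mem_smul hz, rfl⟩

end Transport

/-- **`L₀ = F(S)` is generated by `S`** in the form used by BSZ §3: inside the subfield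
`L₀ = F(S)`, a nonzero finite-dimensional subspace `Y` with `Y S ⊆ Y` is everything (its
stabiliser is a subfield containing `S`). [cite: BachocSerraZemor2018Kneser, Section 3 (`𝒮_0 = {0, L}`)] -/
theorem gen_of_adjoin (S : Submodule F L) [FiniteDimensional F S] (L₀ : IntermediateField F L)
    (hL₀ : IntermediateField.adjoin F (S : Set L) = L₀) (Y : Submodule F ↥L₀)
    (hY : FiniteDimensional F Y) (hYS : Y * S.comap (incl L₀) ≤ Y) : Y = ⊥ ∨ Y = ⊤ := by
  have hSL₀ : (S : Set L) ⊆ L₀ := hL₀ ▸ IntermediateField.subset_adjoin F _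
  by_cases hYb : Y = ⊥
  · exact Or.inl hYb
  right
  haveI := hY
  have hXS : Y.map (incl L₀) * S ≤ Y.map (incl L₀) := by
    have := Submodule.map_mono (f := incl L₀) hYS
    rwa [map_incl_mul, map_comap_incl L₀ hSL₀] at this
  have hXb : Y.map (incl L₀) ≠ ⊥ := by
    intro h
    apply hYb
    exact Submodule.map_injective_of_injective (incl_injective L₀) (by rw [Submodule.map_bot]; exact h)
  obtain ⟨x₀, hx₀, hx₀0⟩ := (Submodule.ne_bot_iff (Y.map (incl L₀))).mp hXb
  have hL₀K : L₀ ≤ stabField (Y.map (incl L₀)) := by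
    have : IntermediateField.adjoin F (S : Set L) ≤ stabField (Y.map (incl L₀)) := by
      rw [IntermediateField.adjoin_le_iff]
      intro s hs
      rw [SetLike.mem_coe, mem_stabField]
      intro x hx
      rw [mul_comm]
      exact hXS (Submodule.mul_mem_mul hx hs)
    exact hL₀.symm.le.trans this
  have hXL₀ : ((Y.map (incl L₀) : Submodule F L) : Set L) ⊆ L₀ := by
    rintro _ ⟨y, -, rfl⟩
    exact y.2
  rw [eq_top_iff]
  rintro ⟨l, hl⟩ -
  have hlX : l ∈ Y.map (incl L₀) := by
    have hmem : l * x₀⁻¹ ∈ stabField (Y.map (incl L₀)) :=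
      hL₀K (L₀.mul_mem hl (L₀.inv_mem (hXL₀ hx₀)))
    have := hmem x₀ hx₀
    rwa [inv_mul_cancel_right₀ hx₀0] at this
  obtain ⟨y, hy, hyl⟩ := hlX
  have : y = ⟨l, hl⟩ := Subtype.ext hyl
  exact this ▸ hy

/-! ### BSZ Theorem 3 ⇒ Theorem 2 for an arbitrary extension -/

/-- For `1 ∈ S` and `T ≠ 0` with `dim ST ≤ dim S + dim T - 2` there is `k ∉ F` stabilising
`ST` (BSZ Theorem 3 applied inside `F(S)` to the pieces `T ∩ t F(S)`, then summed).
[cite: BachocSerraZemor2018Kneser, Section 4] -/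
theorem exists_mem_mulStabilizer_of_one_mem (S T : Submodule F L) [FiniteDimensional F S]
    [FiniteDimensional F T] (h1 : (1 : L) ∈ S) (hT : T ≠ ⊥)
    (hsmall : finrank F ↥(S * T) + 2 ≤ finrank F S + finrank F T) :
    ∃ k ∈ mulStabilizer (S * T), k ∉ Submodule.span F {(1 : L)} := by
  set L₀ := IntermediateField.adjoin F (S : Set L) with hL₀
  have hSL₀ : (S : Set L) ⊆ L₀ := IntermediateField.subset_adjoin F _
  let M₀ : Submodule F L := Subalgebra.toSubmodule L₀.toSubalgebra
  have hM₀ : ∀ {x : L}, x ∈ M₀ ↔ x ∈ L₀ := Iff.rfl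
  -- the pieces `T_t = T ∩ t L₀` have small product
  have hpiece_le : ∀ t : L, S * (T ⊓ t • M₀) ≤ t • M₀ := by
    intro t
    rw [Submodule.mul_le]
    rintro s hs u ⟨-, hu⟩
    obtain ⟨m, hm, rfl⟩ := mem_smul_iff.mp hu
    rw [mul_left_comm]
    exact mul_mem_smul (L₀.mul_mem (hSL₀ hs) hm)
  have hsmall_t : ∀ t : L, finrank F ↥(S * (T ⊓ t • M₀)) + 2 ≤ finrank F S + finrank F ↥(T ⊓ t • M₀) := by
    intro t
    have hsup : S * (T ⊓ t • M₀) ⊔ T ≤ S * T :=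
      sup_le (mul_le_mul_right inf_le_left S) (le_mul_of_one_mem_left h1 T)
    have hinf : S * (T ⊓ t • M₀) ⊓ T ≤ T ⊓ t • M₀ :=
      le_inf inf_le_right (inf_le_left.trans (hpiece_le t))
    have m := Submodule.finrank_sup_add_finrank_inf_eq (S * (T ⊓ t • M₀)) T
    have i1 := Submodule.finrank_mono hsup
    have i2 := Submodule.finrank_mono hinf
    omega
  -- the rescaled pieces `U_t = t⁻¹ T_t ≤ L₀`
  have hU_le : ∀ {t : L}, t ≠ 0 → ((t⁻¹ • (T ⊓ t • M₀) : Submodule F L) : Set L) ⊆ L₀ := by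
    intro t ht x hx
    have : t⁻¹ • (T ⊓ t • M₀) ≤ M₀ := by
      calc t⁻¹ • (T ⊓ t • M₀) ≤ t⁻¹ • t • M₀ := smul_mono inf_le_right
        _ = M₀ := inv_smul_smul ht M₀
    exact this hx
  have hSU : ∀ {t : L}, t ≠ 0 → S * (t⁻¹ • (T ⊓ t • M₀)) = t⁻¹ • (S * (T ⊓ t • M₀)) := by
    intro t ht
    rw [mul_comm, smul_mul, mul_comm]
  -- transport to `↥L₀`
  set S' : Submodule F ↥L₀ := S.comap (incl L₀) with hS'
  haveI : FiniteDimensional F S' := finiteDimensional_comap_incl L₀ hSL₀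
  have h1' : (1 : ↥L₀) ∈ S' := by
    change ((1 : ↥L₀) : L) ∈ S
    simpa using h1
  have hfinS' : finrank F S' = finrank F S := finrank_comap_incl L₀ hSL₀
  -- data of the piece at `t`
  have hdata : ∀ {t : L}, t ∈ T → t ≠ 0 →
      FiniteDimensional F ↥((t⁻¹ • (T ⊓ t • M₀)).comap (incl L₀)) ∧
      (t⁻¹ • (T ⊓ t • M₀)).comap (incl L₀) ≠ ⊥ ∧
      finrank F ↥((t⁻¹ • (T ⊓ t • M₀)).comap (incl L₀) * S') + 2 ≤
        finrank F ↥((t⁻¹ • (T ⊓ t • M₀)).comap (incl L₀)) + finrank F S' := by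
    intro t htT ht0
    have hsub := hU_le ht0
    refine ⟨finiteDimensional_comap_incl L₀ hsub, ?_, ?_⟩
    · have htM : t ∈ t • M₀ := by simpa using mul_mem_smul (a := t) (X := M₀) (hM₀.mpr L₀.one_mem)
      have h1U : (1 : L) ∈ t⁻¹ • (T ⊓ t • M₀) :=
        mem_smul_iff.mpr ⟨t, ⟨htT, htM⟩, inv_mul_cancel₀ ht0⟩
      refine ne_bot_of_mem' (x := (1 : ↥L₀)) ?_ one_ne_zero
      change ((1 : ↥L₀) : L) ∈ t⁻¹ • (T ⊓ t • M₀)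
      simpa using h1U
    · rw [hS', comap_incl_mul L₀ hsub hSL₀, finrank_comap_incl L₀ ?_, finrank_comap_incl L₀ hsub,
        hfinS', mul_comm, hSU ht0, finrank_smul (inv_ne_zero ht0), finrank_smul (inv_ne_zero ht0),
        add_comm (finrank F ↥(T ⊓ t • M₀))]
      · exact hsmall_t t
      · rw [mul_comm, hSU ht0]
        intro x hx
        have : t⁻¹ • (S * (T ⊓ t • M₀)) ≤ M₀ := by
          calc t⁻¹ • (S * (T ⊓ t • M₀)) ≤ t⁻¹ • t • M₀ := smul_mono (hpiece_le t)
            _ = M₀ := inv_smul_smul ht0 M₀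
        exact this hx
  -- apply Theorem 3 inside `L₀`
  obtain ⟨t₀, ht₀, ht₀0⟩ := (Submodule.ne_bot_iff T).mp hT
  obtain ⟨k', hk'1, hk'⟩ := exists_smul_le_of_gen S' h1' (fun Y hY hYS => gen_of_adjoin S L₀ hL₀.symm Y hY hYS)
    ⟨_, (hdata ht₀ ht₀0).1, (hdata ht₀ ht₀0).2.1, (hdata ht₀ ht₀0).2.2⟩
  refine ⟨(k' : L), ?_, ?_⟩
  · -- `k` stabilises every `S T_t`, hence `ST`
    have hkt : ∀ {t : L}, t ∈ T → t ≠ 0 → (k' : L) • (S * (T ⊓ t • M₀)) ≤ S * (T ⊓ t • M₀) := by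
      intro t htT ht0
      obtain ⟨hfd, hne, hsm⟩ := hdata htT ht0
      have h := hk' _ hfd hne hsm
      have h' := Submodule.map_mono (f := incl L₀) h
      rw [map_incl_smul, map_incl_mul, hS', map_comap_incl L₀ (hU_le ht0), map_comap_incl L₀ hSL₀,
        mul_comm, hSU ht0] at h'
      -- `h' : k • t⁻¹ • (S T_t) ≤ t⁻¹ • (S T_t)`; rescale by `t`
      have h'' := smul_mono (a := t) h'
      rwa [smul_comm t (k' : L), smul_inv_smul₀ ht0] at h''
    intro z hz
    refine Submodule.mul_induction_on hz (fun s hs t ht => ?_) (fun a b ha hb => ?_)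
    · by_cases ht0 : t = 0
      · rw [ht0, mul_zero, mul_zero]
        exact Submodule.zero_mem _
      have htM : t ∈ t • M₀ := by simpa using mul_mem_smul (a := t) (X := M₀) (hM₀.mpr L₀.one_mem)
      have htt : t ∈ T ⊓ t • M₀ := ⟨ht, htM⟩
      have hst : (k' : L) * (s * t) ∈ (k' : L) • (S * (T ⊓ t • M₀)) :=
        mul_mem_smul (Submodule.mul_mem_mul hs htt)
      exact mul_le_mul_right inf_le_left S (hkt ht ht0 hst)
    · rw [mul_add]
      exact Submodule.add_mem _ ha hb
  · intro hk
    apply hk'1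
    obtain ⟨c, hc⟩ := Submodule.mem_span_singleton.mp hk
    refine Submodule.mem_span_singleton.mpr ⟨c, Subtype.ext ?_⟩
    simpa using hc

/-- **BSZ Theorem 2 (dichotomy), Hou–Leung–Xiang without separability**: for nonzero
finite-dimensional `S, T` with `dim ST ≤ dim S + dim T - 2`, the stabiliser `H(ST)` contains an
element outside `F`. [cite: BachocSerraZemor2018Kneser, Theorems 2 and 3] -/
theorem exists_mem_mulStabilizer (S T : Submodule F L) [FiniteDimensional F S]
    [FiniteDimensional F T] (hS : S ≠ ⊥) (hT : T ≠ ⊥)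
    (hsmall : finrank F ↥(S * T) + 2 ≤ finrank F S + finrank F T) :
    ∃ k ∈ mulStabilizer (S * T), k ∉ Submodule.span F {(1 : L)} := by
  obtain ⟨s₀, hs₀, hs₀0⟩ := (Submodule.ne_bot_iff S).mp hS
  have h1 : (1 : L) ∈ s₀⁻¹ • S := mem_smul_iff.mpr ⟨s₀, hs₀, inv_mul_cancel₀ hs₀0⟩
  have hsm : finrank F ↥(s₀⁻¹ • S * T) + 2 ≤ finrank F ↥(s₀⁻¹ • S) + finrank F T := by
    rw [smul_mul, finrank_smul (inv_ne_zero hs₀0), finrank_smul (inv_ne_zero hs₀0)]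
    exact hsmall
  obtain ⟨k, hk, hk1⟩ := exists_mem_mulStabilizer_of_one_mem (s₀⁻¹ • S) T h1 hT hsm
  refine ⟨k, ?_, hk1⟩
  rw [smul_mul] at hk
  exact (mem_mulStabilizer_smul_iff (inv_ne_zero hs₀0)).mp hk

/-! ### Change of base field to an intermediate field `K` -/

section BaseChange

variable (K : IntermediateField F L)

/-- The `K`-span of an `F`-subspace of `L`. [folklore] -/
def spanK (X : Submodule F L) : Submodule K L := Submodule.span K (X : Set L)

/-- `X ≤ K X`. [folklore] -/
theorem le_spanK (X : Submodule F L) : X ≤ (spanK K X).restrictScalars F :=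
  fun _ hx => Submodule.subset_span hx

/-- `(K X)(K Y) = K (X Y)`. [folklore] -/
theorem spanK_mul (X Y : Submodule F L) : spanK K X * spanK K Y = spanK K (X * Y) := by
  simp only [spanK]
  rw [Submodule.span_mul_span, Submodule.mul_eq_span_mul_set X Y, Submodule.span_span_of_tower]

/-- `K X` is finite-dimensional over `K` when `X` is over `F`. [folklore] -/
theorem finiteDimensional_spanK (X : Submodule F L) [hX : FiniteDimensional F X] :
    FiniteDimensional K (spanK K X) := by
  obtain ⟨t, ht⟩ := Module.Finite.iff_fg.mp hX
  refine Module.Finite.iff_fg.mpr (Submodule.fg_def.mpr ⟨(t : Set L), t.finite_toSet, ?_⟩)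
  simp only [spanK]
  rw [← ht, Submodule.span_span_of_tower]

/-- `K X ≠ 0` for `X ≠ 0`. [folklore] -/
theorem spanK_ne_bot {X : Submodule F L} (hX : X ≠ ⊥) : spanK K X ≠ ⊥ := by
  obtain ⟨x, hx, hx0⟩ := (Submodule.ne_bot_iff X).mp hX
  exact ne_bot_of_mem' (Submodule.subset_span (s := (X : Set L)) hx) hx0

/-- The `K`-span of a `K`-stable `F`-subspace has the same underlying set. [folklore] -/
theorem coe_spanK_of_stable (X : Submodule F L) (hK : ∀ k ∈ K, ∀ x ∈ X, k * x ∈ X) :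
    ((spanK K X : Submodule K L) : Set L) = X := by
  let X' : Submodule K L :=
    { carrier := X
      add_mem' := fun ha hb => X.add_mem ha hb
      zero_mem' := X.zero_mem
      smul_mem' := fun c x hx => hK c c.2 x hx }
  have : spanK K X = X' :=
    le_antisymm (Submodule.span_le.mpr fun x hx => hx) fun x hx => Submodule.subset_span hx
  rw [this]
  rfl

/-- A `K`-subspace viewed over `F`. [folklore] -/
def restrictEquiv (P : Submodule K L) : ↥(P.restrictScalars F) ≃ₗ[F] ↥P :=
  { toFun := fun x => ⟨x.1, x.2⟩
    invFun := fun x => ⟨x.1, x.2⟩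
    map_add' := fun _ _ => rfl
    map_smul' := fun _ _ => rfl
    left_inv := fun _ => rfl
    right_inv := fun _ => rfl }

/-- Tower law for a `K`-subspace of `L`: `[K:F] · dim_K P = dim_F P`. [folklore] -/
theorem finrank_mul_finrank_submodule (P : Submodule K L) :
    finrank F K * finrank K P = finrank F ↥(P.restrictScalars F) := by
  rw [Module.finrank_mul_finrank F K ↥P]
  exact (restrictEquiv K P).finrank_eq.symm

/-- A `K`-subspace that is finite-dimensional over `K` (with `[K:F] < ∞`) is finite-dimensional
over `F`. [folklore] -/
theorem finiteDimensional_restrictScalars [FiniteDimensional F K] (P : Submodule K L)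
    [FiniteDimensional K P] : FiniteDimensional F ↥(P.restrictScalars F) := by
  haveI : Module.Finite F ↥P := Module.Finite.trans K ↥P
  exact Module.Finite.equiv (restrictEquiv K P).symm

/-- Subspaces with the same underlying set have the same dimension. [folklore] -/
theorem finrank_eq_of_coe_eq {P : Submodule K L} {X : Submodule F L} (h : (P : Set L) = X) :
    finrank F ↥(P.restrictScalars F) = finrank F X := by
  have : P.restrictScalars F = X :=
    Submodule.ext fun x => by rw [Submodule.restrictScalars_mem]; exact Set.ext_iff.mp h x
  rw [this]

end BaseChange

/-! ### The theorem -/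

/-- **Kneser's theorem for field extensions** (Hou–Leung–Xiang; Bachoc–Serra–Zémor, no
separability), by strong induction on `dim_F ST`: if `dim ST ≤ dim S + dim T - 2`, BSZ
Theorem 2 gives `[K:F] ≥ 2` for the field `K = H(ST)`; over `K`, `(KS)(KT) = ST` has smaller
dimension and stabiliser `K`, and the tower law brings the `K`-inequality back to `F`.
[cite: BachocSerraZemor2018Kneser, Theorem 2 and the display following it] -/
theorem kneser_aux : ∀ (d : ℕ) (F L : Type) [Field F] [Field L] [Algebra F L]
    (S T : Submodule F L), FiniteDimensional F S → FiniteDimensional F T → S ≠ ⊥ → T ≠ ⊥ →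
      finrank F ↥(S * T) = d →
      finrank F S + finrank F T ≤ finrank F ↥(S * T) + finrank F (mulStabilizer (S * T)) := by
  intro d
  induction d using Nat.strong_induction_on with
  | _ d IH => ?_
  intro F L _ _ _ S T hS hT hSb hTb hd
  haveI := hS
  haveI := hT
  haveI : FiniteDimensional F ↥(S * T) := finiteDimensional_mul S T
  have hSTb : S * T ≠ ⊥ := fun h => by
    rcases Submodule.mul_eq_bot.mp h with h | h
    exacts [hSb h, hTb h]
  haveI hH : FiniteDimensional F (mulStabilizer (S * T)) := finiteDimensional_mulStabilizer hSTb
  haveI hH' : FiniteDimensional F ↥(Subalgebra.toSubmodule (mulStabilizer (S * T))) := hH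
  have hH1 : 1 ≤ finrank F (mulStabilizer (S * T)) := by
    refine Nat.pos_of_ne_zero fun h0 => ?_
    have hbot : Subalgebra.toSubmodule (mulStabilizer (S * T)) = ⊥ :=
      Submodule.finrank_eq_zero.mp (by rwa [Subalgebra.finrank_toSubmodule])
    have h1 : (1 : L) ∈ Subalgebra.toSubmodule (mulStabilizer (S * T)) := (mulStabilizer (S * T)).one_mem
    rw [hbot] at h1
    exact one_ne_zero ((Submodule.mem_bot F).mp h1)
  by_cases hsm : finrank F ↥(S * T) + 2 ≤ finrank F S + finrank F T
  swap
  · omega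
  obtain ⟨k, hk, hk1⟩ := exists_mem_mulStabilizer S T hSb hTb hsm
  set K := stabField (S * T) with hKdef
  have hKstab : ∀ c ∈ K, ∀ x ∈ S * T, c * x ∈ S * T := fun c hc => hc
  haveI : FiniteDimensional F K := Module.Finite.equiv (stabFieldEquiv (S * T)).symm
  have hfK : 2 ≤ finrank F K := by
    rw [hKdef, finrank_stabField, ← Subalgebra.finrank_toSubmodule]
    have hlt : Submodule.span F {(1 : L)} < Subalgebra.toSubmodule (mulStabilizer (S * T)) := by
      refine lt_of_le_of_ne ((Submodule.span_singleton_le_iff_mem _ _).mpr (mulStabilizer (S * T)).one_mem)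
        fun h => hk1 ?_
      rw [h]
      exact hk
    have := Submodule.finrank_lt_finrank_of_lt hlt
    rw [finrank_span_singleton one_ne_zero] at this
    omega
  -- base change to `K`
  haveI := finiteDimensional_spanK K S
  haveI := finiteDimensional_spanK K T
  haveI : FiniteDimensional K ↥(spanK K S * spanK K T) := finiteDimensional_mul _ _
  have hmul := spanK_mul K S T
  have hcoe : ((spanK K (S * T) : Submodule K L) : Set L) = (S * T : Submodule F L) :=
    coe_spanK_of_stable K (S * T) hKstab
  have hd' : finrank F K * finrank K ↥(spanK K S * spanK K T) = finrank F ↥(S * T) := by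
    rw [hmul, finrank_mul_finrank_submodule K, finrank_eq_of_coe_eq K hcoe]
  have hstabK : ((Subalgebra.toSubmodule (mulStabilizer (spanK K S * spanK K T)) : Submodule K L) : Set L) =
      (Subalgebra.toSubmodule (mulStabilizer (S * T)) : Submodule F L) := by
    ext c
    simp only [Subalgebra.coe_toSubmodule, SetLike.mem_coe, mem_mulStabilizer]
    rw [hmul]
    constructor
    · intro h x hx
      have hx' : x ∈ spanK K (S * T) := by
        rw [← SetLike.mem_coe, hcoe]
        exact hx
      have := h x hx'
      rwa [← SetLike.mem_coe, hcoe] at this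
    · intro h x hx
      rw [← SetLike.mem_coe, hcoe, SetLike.mem_coe] at hx
      have := h x hx
      rw [← SetLike.mem_coe, hcoe]
      exact this
  have hHK : finrank F K * finrank K (mulStabilizer (spanK K S * spanK K T)) =
      finrank F (mulStabilizer (S * T)) := by
    rw [← Subalgebra.finrank_toSubmodule, finrank_mul_finrank_submodule K, finrank_eq_of_coe_eq K hstabK,
      Subalgebra.finrank_toSubmodule]
  have hSle : finrank F S ≤ finrank F K * finrank K (spanK K S) := by
    rw [finrank_mul_finrank_submodule K]
    haveI := finiteDimensional_restrictScalars K (spanK K S)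
    exact Submodule.finrank_mono (le_spanK K S)
  have hTle : finrank F T ≤ finrank F K * finrank K (spanK K T) := by
    rw [finrank_mul_finrank_submodule K]
    haveI := finiteDimensional_restrictScalars K (spanK K T)
    exact Submodule.finrank_mono (le_spanK K T)
  -- induction hypothesis over `K`
  have hlt : finrank K ↥(spanK K S * spanK K T) < d := by
    have h2 := Nat.mul_le_mul_right (finrank K ↥(spanK K S * spanK K T)) hfK
    rw [hd', hd] at h2
    have hdpos : 0 < d := by
      rw [← hd]
      exact Nat.pos_of_ne_zero fun h0 => hSTb (Submodule.finrank_eq_zero.mp h0)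
    omega
  have hIH := IH _ hlt (↥K) L (spanK K S) (spanK K T) inferInstance inferInstance
    (spanK_ne_bot K hSb) (spanK_ne_bot K hTb) rfl
  have hmulIH := Nat.mul_le_mul_left (finrank F K) hIH
  rw [mul_add, mul_add, hd', hHK] at hmulIH
  omega

end LinKneser

/-- **Kneser's theorem for field extensions** — discharge of the named fact
`Literature.Combinatorics.Additive.LinearKneser` (Hou–Leung–Xiang 2002, main theorem, in the
stabiliser form `dim_F ST + dim_F H(ST) ≥ dim_F S + dim_F T`, WITHOUT the separability
assumption: Bachoc–Serra–Zémor 2018, Theorem 3 ⇒ Theorem 2), proved in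
`LinearKneserBoundary/Duality/Kernels/Proofs.lean` following BSZ §2–§4.
[cite: BachocSerraZemor2018Kneser, Theorems 2 and 3]
[cite: HouLeungXiang2002, main theorem (as quoted in BachocSerraZemor2018Kneser, Thm 2)] -/
theorem LinearKneser_holds : LinearKneser := by
  intro F L _ _ _ S T hS hT hSb hTb
  exact LinKneser.kneser_aux _ F L S T hS hT hSb hTb rfl

namespace LinKneser
end Literature.Combinatorics.Additive.LinKneser
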